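import Literature.NumberTheory.PAdicHodge.KummerUnitPadicCocycle
import Literature.NumberTheory.PAdicHodge.BdRPlusScalarCochainContinuity
import Literature.NumberTheory.GaloisCohomology.MuPadicLine
import Literature.NumberTheory.GaloisRepresentations.ContinuousCupProductCoboundaryLift
import HarnessLib

/-!
# The period line `ℤ_p(1)(F̄) → B_dR⁺(F)`, `ε^a ↦ a · t`: Fontaine's `ε` as a point of the Tate module, the Kummer
# cocycle in the `ε`-coordinate, and Bloch–Kato Ex. 3.10.1 for `𝔾_m` as a coboundary lift

Topic `Literature/NumberTheory/PAdicHodge`. Glue between three pieces of the tree which so far lived in different coordinates: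
the Tate module `ℤ_p(1)(F̄) = lim_k μ_{p^k}(F̄)` as a continuous representation (`GaloisCohomology.tateModuleMuPadic`; its
`ℤ_p`-line structure `twistHom`/`padicLineEquiv`/`IsPrimitiveSystem`, `MuPadicLine`; the `p`-adic Kummer class `kummerPadic` and its
explicit cocycle `rootKummerCocycle`, `KummerUnitPadicCocycle`); Fontaine's `ε = (ζ_{pᵏ})_k` (`epsRaw`, `CyclotomicTilt`) with
`t = log[ε]` (`tBdR`, `σ t = χ(σ) t`; `log[ε^a] = a · t`, `BdRPlusLogOneAdd`) and the `B_dR⁺`-integral `ℓ_u` of the Kummer cocycle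
of a unit, `(σ − 1) ℓ_u = a(σ) · t` (`BdRKummerUnitPeriod.gal_kummerUnitLog_eq`); and the cochain calculus of connecting classes
with an ALGEBRAIC ambient (`GaloisRepresentations.IsCoboundaryLift`, `ContPairing.isCoboundaryLift_cupCocycle_left`) plus the
def-free Fontaine-continuity of scalar cochains `σ ↦ a(σ) · t` (`BdRPlusScalarCochainContinuity`).

* §1 `epsMuPadic F p : ℤ_p(1)(F̄)` — Fontaine's `ε` AS A POINT OF THE TREE'S TATE MODULE (coordinates `ζ_{pᵏ} = epsRaw p k`),
  ★ `isPrimitiveSystem_epsMuPadic`; `epsLineEquiv F p : ℤ_p ≃+ ℤ_p(1)(F̄)`, `a ↦ ε^a` (`coe_muVal_epsLineEquiv`: coordinates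
  `ζ_{pᵏ}^{a mod pᵏ}`; `σ ε^a = ε^{χ(σ) a}` is `MuPadicLine.tateModuleMuPadic_twistHom`).
* §2 ★ `rootKummerCocycle_apply_eq_epsLineEquiv` — **the `p`-adic Kummer cocycle of `u ∈ Fˣ` IS `σ ↦ ε^{a(σ)}`**, `a(σ) =
  kummerExp σ ∈ ℤ_p`: in the `ε`-coordinate the cocycle representing `κ_∞(u)` is the Kummer exponent.
* §3 `BdRPlusTop.periodLine F p : ℤ_p(1)(F̄) →+ B_dR⁺(F)`, **`ε^a ↦ a · t`** (`periodLine_epsLineEquiv`, `periodLine_epsMuPadic :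
  ε ↦ t`, ★ `periodLine_epsLineEquiv_eq_logOneAdd : ι(ε^a) = log[ε^a]`), `periodLine_twistHom : ι(ζ^a) = a · ι(ζ)`,
  ★ `gal_periodLine` (**`Γ_F`-equivariance**), `periodLine_mem_filOne`, ★ `periodLine_injective` (`θ` onto), the range `ℤ_p · t`
  (`mem_range_periodLine_iff`); `BdRPlusTop.galRepr F p` — the action of `Γ_F` on `B_dR⁺(F)` as a Mathlib `Representation ℤ`
  (the ambient `π` of `IsCoboundaryLift`), `periodLine_tateModuleMuPadic_eq_galRepr` (its hypothesis `hι`).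
* §4 ★ `continuous_of_uc_periodLine` / `uc_periodLine_of_continuous` — **`h : Γ_F → ℤ_p(1)(F̄)` is continuous iff `σ ↦ ι(h σ)`
  is Fontaine-continuous** (`BdRPlusScalarCochainContinuity` + the homeomorphism `epsLineEquiv`): the continuity hypothesis of
  `IsCoboundaryLift.twoCocycleClass_eq` for `ℤ_p(1)`-valued correction cochains, in `B_dR⁺`-currency.
* §5 ★★ `periodLine_rootKummerCocycle` — **Bloch–Kato Ex. 3.10.1 for `𝔾_m` as a coboundary lift**: `ι(κ_u(σ)) = σ ℓ_u − ℓ_u` for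
  EVERY `σ ∈ Γ_F` (`u ∈ F`, `0 < |u| ≤ 1`) — verbatim the hypothesis `ha` of `ContPairing.isCoboundaryLift_cupCocycle_left`; hence
  ★★ `isCoboundaryLift_twistPairingPadic_rootKummerCocycle`: for every continuous character cocycle `b : Γ_F → ℤ_p` the cochain
  **`τ ↦ b(τ) · ℓ_u` presents `κ_u ∪ b`** in `H²(F, ℤ_p(1))` through `ι` (Kato, LNM 1553, II §1.4.4: the cochain `log χ(τ) · ℓ_u`),
  and `cupClass_rootKummerCocycle_eq_twoCocycleClass` (any presentation of that cochain computes `[κ_u ∪ b]`).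

Definitions (reviewed): `epsMuPadic`, `epsLineEquiv` (abbrev), `BdRPlusTop.periodLine`, `BdRPlusTop.galRepr`,
`BdRPlusTop.unitKummerLog` (abbrev). No named fact, no instance, no `sorry`. Bookkeeping for the `B_dR⁺`-currency of Kato's
explicit reciprocity law (line `kato_lever` of crux K★ `stmt-BirchSwinnertonDyer-22226`, memos `Lines/kato-lever-K3-B2-road.md` (H5),
`Lines/kato-lever-K3-floor-b.md` §3); BSD / K★ / [REC] are NOT proved by any of this.

## References
* J.-M. Fontaine, *Le corps des périodes p-adiques*, Astérisque 223 (1994), Exp. II §1.2.2, §1.5.4–1.5.5. [FontaineAsterisque223III]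
* S. Bloch, K. Kato, *L-functions and Tamagawa numbers of motives* (1990), Ex. 3.10.1 (Kummer = `exp` for `𝔾_m`). [BlochKato1990]
* K. Kato, LNM 1553 (1993), Ch. II 1.4.2, §1.4.4, proof of Lemma 1.4.3. [Kato1993LNM1553]
* J.-P. Serre, *Abelian ℓ-adic representations and elliptic curves* (1968), Ch. I §1.2 (`ℤ_ℓ(1)`). [Serre1968]
-/

noncomputable section

open Field Function ValuativeRel WittVector

namespace Literature.NumberTheory.PAdicHodge

open Literature.NumberTheory.GaloisRepresentations
open Literature.NumberTheory.GaloisRepresentations.IsNonarchimedeanLocalField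
open Literature.NumberTheory.GaloisRepresentations.DiscreteGaloisModule
open Literature.NumberTheory.GaloisCohomology
open Literature.AnabelianGeometry.AbsoluteAnabelian

variable {F : Type} [Field F] [ValuativeRel F] [TopologicalSpace F] [IsNonarchimedeanLocalField F] [CharZero F]
  {p : ℕ} [Fact p.Prime]

/-! ## §1 Fontaine's `ε` as a point of `ℤ_p(1)(F̄)` -/

section Eps

variable (F p) in
/-- **Fontaine's `ε = (ζ_{pᵏ})_k` as a point of the tree's Tate module `ℤ_p(1)(F̄) = lim_k μ_{pᵏ}(F̄)`** (`tateModuleMuPadic F p`):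
the compatible system `epsRaw p` of `CyclotomicTilt` (whose reduction mod `p` is the tilt element `eps`, and whose logarithm
of the Teichmüller lift is `t = tBdR`); compatibility `ζ_{pᵐ}^{p^{m−k}} = ζ_{pᵏ}` is `BdRPlusTop.epsRaw_pow_pow_sub`.
[cite: FontaineAsterisque223III, Exp. II §1.2.2 and §1.5.4] [cite: Serre1968, Ch. I §1.2] -/
def epsMuPadic : (muPadicSystem F p).limit :=
  ⟨fun k => MuCarrier.ofRootsOfUnity
      (rootsOfUnity.mkOfPowEq (NormedAlgClosure.toAlgClosure (epsRaw p k : NormedAlgClosure F))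
        (by rw [← map_pow, epsRaw_pow, map_one])),
    fun k m h => muVal_injective F (p ^ k) (Units.ext (by
      rw [muPadicSystem_red, muVal_muPow, Units.val_pow_eq_pow_val]
      change NormedAlgClosure.toAlgClosure (epsRaw p m : NormedAlgClosure F) ^ p ^ (m - k) =
        NormedAlgClosure.toAlgClosure (epsRaw p k : NormedAlgClosure F)
      rw [← map_pow, BdRPlusTop.epsRaw_pow_pow_sub h]))⟩

/-- ★ **Coordinates of `ε`**: the `k`-th coordinate of `epsMuPadic` is `ζ_{pᵏ} = epsRaw p k` (read in `AlgebraicClosure F`).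
[cite: FontaineAsterisque223III, Exp. II §1.2.2] -/
theorem coe_muVal_epsMuPadic (k : ℕ) :
    ((muVal F (p ^ k) (((epsMuPadic F p : (muPadicSystem F p).limit) : ∀ k, MuCarrier F (p ^ k)) k) :
        (AlgebraicClosure F)ˣ) : AlgebraicClosure F) =
      NormedAlgClosure.toAlgClosure (epsRaw p k : NormedAlgClosure F) := rfl

/-- ★ **`ε` is a compatible system of PRIMITIVE roots of unity** (a topological generator of `ℤ_p(1)(F̄)`).
[cite: FontaineAsterisque223III, Exp. II §1.2.2] [cite: Serre1968, Ch. I §1.2] -/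
theorem isPrimitiveSystem_epsMuPadic : IsPrimitiveSystem F p (epsMuPadic F p) := fun k => by
  rw [coe_muVal_epsMuPadic]
  exact (isPrimitiveRoot_epsRaw k).map_of_injective (NormedAlgClosure.toAlgClosure (F := F)).injective

variable (F p) in
/-- **`ℤ_p ≃ ℤ_p(1)(F̄)`, `a ↦ ε^a`** — the `ℤ_p`-line coordinate of the Tate module given by Fontaine's `ε` (the tree's
`padicLineEquiv` at `epsMuPadic`). Its inverse is the discrete logarithm `log_ε`. [cite: Serre1968, Ch. I §1.2]
[cite: FontaineAsterisque223III, Exp. II §1.2.2] -/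
abbrev epsLineEquiv : ℤ_[p] ≃+ (muPadicSystem F p).limit :=
  padicLineEquiv (epsMuPadic F p) isPrimitiveSystem_epsMuPadic

/-- `epsLineEquiv a = ε^a = twistHom ε a`. [cite: Serre1968, Ch. I §1.2] -/
theorem epsLineEquiv_apply (a : ℤ_[p]) : epsLineEquiv F p a = twistHom F p (epsMuPadic F p) a := rfl

/-- `epsLineEquiv 1 = ε`. [cite: Serre1968, Ch. I §1.2] -/
theorem epsLineEquiv_one : epsLineEquiv F p 1 = epsMuPadic F p := by
  rw [epsLineEquiv_apply, twistHom_one]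

/-- `log_ε ε = 1`. [cite: Serre1968, Ch. I §1.2] -/
theorem epsLineEquiv_symm_epsMuPadic : (epsLineEquiv F p).symm (epsMuPadic F p) = 1 := by
  rw [← epsLineEquiv_one, AddEquiv.symm_apply_apply]

/-- ★ **Coordinates of `ε^a`**: the `k`-th coordinate of `ε^a` is `ζ_{pᵏ}^{(a mod pᵏ)}`. [cite: FontaineOuyang2022, §5.1.2]
[cite: Serre1968, Ch. I §1.2] -/
theorem coe_muVal_epsLineEquiv (a : ℤ_[p]) (k : ℕ) :
    ((muVal F (p ^ k) (((epsLineEquiv F p a : (muPadicSystem F p).limit) : ∀ k, MuCarrier F (p ^ k)) k) :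
        (AlgebraicClosure F)ˣ) : AlgebraicClosure F) =
      NormedAlgClosure.toAlgClosure (epsRaw p k : NormedAlgClosure F) ^ (PadicInt.toZModPow k a).val := by
  rw [epsLineEquiv_apply, coe_twistHom, muVal_twistCoord, Units.val_pow_eq_pow_val, coe_muVal_epsMuPadic]

/-- `log_ε (σ ζ) = χ(σ) · log_ε ζ`: in the `ε`-coordinate `Γ_F` acts on `ℤ_p(1)(F̄)` through the cyclotomic character
(`MuPadicLine.padicLineEquiv_symm_tateModuleMuPadic`). [cite: Serre1968, Ch. I §1.2] -/
theorem epsLineEquiv_symm_tateModuleMuPadic (σ : absoluteGaloisGroup F) (ζ : (muPadicSystem F p).limit) :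
    (epsLineEquiv F p).symm (tateModuleMuPadic F p σ ζ) =
      ((GaloisRep.cyclotomicCharacter F p σ : ℤ_[p]ˣ) : ℤ_[p]) * (epsLineEquiv F p).symm ζ := by
  haveI : NeZero (p : F) := ⟨Nat.cast_ne_zero.2 (Fact.out : p.Prime).ne_zero⟩
  exact padicLineEquiv_symm_tateModuleMuPadic _ _ σ ζ

end Eps

/-! ## §2 The `p`-adic Kummer cocycle in the `ε`-coordinate -/

section Kummer

omit [CharZero F] [Fact p.Prime] in
/-- `u ≠ 0` read in the normed algebraic closure. [folklore] -/
private theorem algebraMap_normedAlgClosure_ne_zero {u : F} (hu : u ≠ 0) : algebraMap F (NormedAlgClosure F) u ≠ 0 :=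
  (map_ne_zero_iff _ (algebraMap F (NormedAlgClosure F)).injective).2 hu

/-- ★ **The `p`-adic Kummer cocycle of `u ∈ Fˣ` is `σ ↦ ε^{a(σ)}`**: the explicit cocycle `rootKummerCocycle p hu` representing
`κ_∞(u) = kummerPadic F p u` (`oneCocycleClass_rootKummerCocycle`) is, in the `ε`-coordinate of `ℤ_p(1)(F̄)`, the Kummer exponent
`a(σ) = kummerExp σ ∈ ℤ_p` of `BdRKummerUnitPeriod` (`σ(u_k) = ζ_{pᵏ}^{a(σ) mod pᵏ} u_k`). [cite: BlochKato1990, Ex. 3.10.1]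
[cite: Kato1993LNM1553, Ch. II 1.4.2] [cite: FontaineAsterisque223III, Exp. II §1.2.2] -/
theorem rootKummerCocycle_apply_eq_epsLineEquiv {u : F} (hu : u ≠ 0) (σ : absoluteGaloisGroup F) :
    (BdRPlusTop.rootKummerCocycle p hu).1 σ = epsLineEquiv F p
      (BdRPlusTop.kummerExp (p := p) σ (algebraMap_normedAlgClosure_ne_zero hu) (NormedAlgClosure.smul_algebraMap σ u)) := by
  refine Subtype.ext (funext fun k => muVal_injective F (p ^ k) (Units.ext ?_))
  rw [BdRPlusTop.coe_muVal_rootKummerCocycle_apply, coe_muVal_epsLineEquiv]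

/-- The same with the discrete logarithm: **`log_ε (κ_u(σ)) = a(σ)`**. [cite: BlochKato1990, Ex. 3.10.1] [cite: Kato1993LNM1553, Ch. II 1.4.2] -/
theorem epsLineEquiv_symm_rootKummerCocycle_apply {u : F} (hu : u ≠ 0) (σ : absoluteGaloisGroup F) :
    (epsLineEquiv F p).symm ((BdRPlusTop.rootKummerCocycle p hu).1 σ) =
      BdRPlusTop.kummerExp (p := p) σ (algebraMap_normedAlgClosure_ne_zero hu) (NormedAlgClosure.smul_algebraMap σ u) := by
  rw [rootKummerCocycle_apply_eq_epsLineEquiv, AddEquiv.symm_apply_apply]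

end Kummer

/-! ## §3 The period line `ι : ℤ_p(1)(F̄) → B_dR⁺(F)`, `ε^a ↦ a · t` -/

namespace BdRPlusTop

variable [Fact (¬ IsUnit (p : integerC F))] [IsAdicComplete (Ideal.span {(p : integerC F)}) (integerC F)]

variable (F p) in
/-- ★ **The period line `ι : ℤ_p(1)(F̄) →+ B_dR⁺(F)`, `ζ ↦ log_ε(ζ) · t`** (so `ε^a ↦ a · t = log[ε^a]`, `ε ↦ t = log[ε]`): the
`Γ_F`-equivariant embedding of the Tate module of `μ_{p^∞}` onto `ℤ_p · t ⊆ Fil¹ B_dR⁺(F)` — Fontaine's `ℤ_p(1) ⊆ B_dR⁺`.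
[cite: FontaineAsterisque223III, Exp. II §1.5.4–1.5.5] [cite: Kato1993LNM1553, Ch. II 1.4.2] -/
def periodLine : (muPadicSystem F p).limit →+ BdRPlusTop F p where
  toFun ζ := of F p (qpToBdR (((epsLineEquiv F p).symm ζ : ℤ_[p]) : ℚ_[p]) * tBdR)
  map_zero' := by rw [map_zero, PadicInt.coe_zero, map_zero, zero_mul, map_zero]
  map_add' ζ ζ' := by rw [map_add, PadicInt.coe_add, map_add, add_mul, map_add]

/-- Unfolding `periodLine`: `ι(ζ) = log_ε(ζ) · t`. [cite: FontaineAsterisque223III, Exp. II §1.5.4] -/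
theorem periodLine_apply (ζ : (muPadicSystem F p).limit) :
    periodLine F p ζ = of F p (qpToBdR (((epsLineEquiv F p).symm ζ : ℤ_[p]) : ℚ_[p]) * tBdR) := rfl

/-- `ι(ζ)` read in `BDeRhamPlus`: `log_ε(ζ) · t`. [cite: FontaineAsterisque223III, Exp. II §1.5.4] -/
theorem of_symm_periodLine (ζ : (muPadicSystem F p).limit) :
    (of F p).symm (periodLine F p ζ) = qpToBdR (((epsLineEquiv F p).symm ζ : ℤ_[p]) : ℚ_[p]) * tBdR := rfl

/-- ★ **`ι(ε^a) = a · t`.** [cite: FontaineAsterisque223III, Exp. II §1.5.4] [cite: Kato1993LNM1553, Ch. II 1.4.2] -/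
theorem periodLine_epsLineEquiv (a : ℤ_[p]) : periodLine F p (epsLineEquiv F p a) = of F p (qpToBdR (a : ℚ_[p]) * tBdR) := by
  rw [periodLine_apply, AddEquiv.symm_apply_apply]

/-- ★ **`ι(ε) = t = log[ε]`.** [cite: FontaineAsterisque223III, Exp. II §1.5.4] -/
theorem periodLine_epsMuPadic : periodLine F p (epsMuPadic F p) = of F p tBdR := by
  rw [periodLine_apply, epsLineEquiv_symm_epsMuPadic, PadicInt.coe_one, map_one, one_mul]

/-- ★ **`ι(ε^a) = log[ε^a]`** — the period line IS the logarithm of the Teichmüller lift on `ε^{ℤ_p}` (the tree's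
`logOneAdd_teichmuller_epsPow`). [cite: FontaineAsterisque223III, Exp. II §1.5.4] [cite: FontaineOuyang2022, §5.1.2] -/
theorem periodLine_epsLineEquiv_eq_logOneAdd (a : ℤ_[p]) :
    periodLine F p (epsLineEquiv F p a) =
      logOneAdd ⟨ofAinf F p (WittVector.teichmuller p (epsPow a : PreTilt (integerC F) p)) - 1,
        ofAinf_teichmuller_epsPow_sub_one_mem_filOne a⟩ := by
  rw [periodLine_epsLineEquiv, logOneAdd_teichmuller_epsPow]

/-- **`ℤ_p`-linearity in twist form: `ι(ζ^a) = a · ι(ζ)`.** [cite: Kato1993LNM1553, Ch. II 1.4.2] -/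
theorem periodLine_twistHom (ζ : (muPadicSystem F p).limit) (a : ℤ_[p]) :
    periodLine F p (twistHom F p ζ a) = of F p (qpToBdR (a : ℚ_[p])) * periodLine F p ζ := by
  obtain ⟨b, rfl⟩ := (epsLineEquiv F p).surjective ζ
  rw [epsLineEquiv_apply, twistHom_twistHom, ← epsLineEquiv_apply, ← epsLineEquiv_apply, periodLine_epsLineEquiv,
    periodLine_epsLineEquiv, ← map_mul]
  congr 1
  rw [PadicInt.coe_mul, map_mul]
  ring

/-- ★ **`Γ_F`-equivariance: `σ(ι ζ) = ι(σ ζ)`** (`σ ζ = ζ^{χ(σ)}` on `ℤ_p(1)` and `σ t = χ(σ) t` in `B_dR⁺`).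
[cite: FontaineAsterisque223III, Exp. II §1.5.5] [cite: Serre1968, Ch. I §1.2] -/
theorem gal_periodLine (σ : absoluteGaloisGroup F) (ζ : (muPadicSystem F p).limit) :
    gal F p σ (periodLine F p ζ) = periodLine F p (tateModuleMuPadic F p σ ζ) := by
  rw [periodLine_apply, periodLine_apply, gal_of, epsLineEquiv_symm_tateModuleMuPadic]
  congr 1
  rw [map_mul, galBdRPlus_qpToBdR, galBdRPlus_tBdR, PadicInt.coe_mul, map_mul]
  ring

/-- `t ∈ Fil¹` read in `BdRPlusTop`. [cite: FontaineAsterisque223III, Exp. II §1.5.4] -/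
private theorem of_tBdR_mem_filOne : of F p tBdR ∈ (filOne F p).toIdeal := tBdR_mem_span_xiBdR

/-- **`ι` takes values in `Fil¹ B_dR⁺ = (ξ)`** (`t ∈ Fil¹`). [cite: FontaineAsterisque223III, Exp. II §1.5.4] -/
theorem periodLine_mem_filOne (ζ : (muPadicSystem F p).limit) : periodLine F p ζ ∈ (filOne F p).toIdeal := by
  rw [periodLine_apply, map_mul]
  exact Ideal.mul_mem_left _ _ of_tBdR_mem_filOne

/-- **`ι(ζ) = 0 ↔ ζ = 0`** (`θ` surjective, so `B_dR⁺` is a domain and `t ≠ 0`). [cite: FontaineAsterisque223III, Exp. II §1.5.4] -/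
theorem periodLine_eq_zero_iff (hF : Function.Surjective (fontaineTheta (integerC F) p)) (ζ : (muPadicSystem F p).limit) :
    periodLine F p ζ = 0 ↔ ζ = 0 := by
  haveI := isDomain_bDeRhamPlus (F := F) (p := p) hF
  refine ⟨fun h => ?_, fun h => by rw [h, map_zero]⟩
  have h1 : (of F p).symm (periodLine F p ζ) = 0 := by rw [h, map_zero]
  rw [of_symm_periodLine] at h1
  rcases mul_eq_zero.1 h1 with h2 | h2
  · rw [map_eq_zero_iff _ (qpToBdR (F := F) (p := p)).injective, PadicInt.coe_eq_zero] at h2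
    rw [← (epsLineEquiv F p).apply_symm_apply ζ, h2, map_zero]
  · exact absurd h2 (tBdR_ne_zero hF)

/-- ★ **`ι` is injective** (`θ` surjective). [cite: FontaineAsterisque223III, Exp. II §1.5.4] -/
theorem periodLine_injective (hF : Function.Surjective (fontaineTheta (integerC F) p)) : Injective (periodLine F p) :=
  (injective_iff_map_eq_zero _).2 fun ζ h => (periodLine_eq_zero_iff hF ζ).1 h

/-- **The range of `ι` is `ℤ_p · t`.** [cite: FontaineAsterisque223III, Exp. II §1.5.4] -/
theorem mem_range_periodLine_iff (x : BdRPlusTop F p) :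
    x ∈ Set.range (periodLine F p) ↔ ∃ a : ℤ_[p], x = of F p (qpToBdR (a : ℚ_[p]) * tBdR) := by
  constructor
  · rintro ⟨ζ, rfl⟩
    exact ⟨(epsLineEquiv F p).symm ζ, periodLine_apply ζ⟩
  · rintro ⟨a, rfl⟩
    exact ⟨epsLineEquiv F p a, periodLine_epsLineEquiv a⟩

variable (F p) in
/-- **The action of `Γ_F` on `B_dR⁺(F)` as a Mathlib `Representation ℤ`** (`σ ↦ gal F p σ` as an additive map) — the ambient
`π` of the cochain calculus `GaloisRepresentations.IsCoboundaryLift` in `B_dR⁺`-currency. [cite: FontaineAsterisque223III, Exp. II §1.5] -/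
def galRepr : Representation ℤ (absoluteGaloisGroup F) (BdRPlusTop F p) where
  toFun σ := (gal F p σ : BdRPlusTop F p →+* BdRPlusTop F p).toAddMonoidHom.toIntLinearMap
  map_one' := by
    refine LinearMap.ext fun x => ?_
    have h := gal_of (F := F) (p := p) 1 ((of F p).symm x)
    rw [galBdRPlus_one, RingEquiv.apply_symm_apply] at h
    exact h
  map_mul' σ τ := by
    refine LinearMap.ext fun x => ?_
    have h := gal_of (F := F) (p := p) (σ * τ) ((of F p).symm x)
    rw [galBdRPlus_mul, ← gal_of, ← gal_of, RingEquiv.apply_symm_apply] at h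
    exact h

/-- Unfolding `galRepr`. [cite: FontaineAsterisque223III, Exp. II §1.5] -/
@[simp] theorem galRepr_apply (σ : absoluteGaloisGroup F) (x : BdRPlusTop F p) : galRepr F p σ x = gal F p σ x := rfl

/-- The equivariance of `ι` in the shape of the hypothesis `hι` of `IsCoboundaryLift.twoCocycleClass_eq`:
`ι (σ ζ) = π σ (ι ζ)`. [cite: FontaineAsterisque223III, Exp. II §1.5.5] -/
theorem periodLine_tateModuleMuPadic_eq_galRepr (σ : absoluteGaloisGroup F) (ζ : (muPadicSystem F p).limit) :
    periodLine F p (tateModuleMuPadic F p σ ζ) = galRepr F p σ (periodLine F p ζ) := by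
  rw [galRepr_apply, gal_periodLine]

/-! ## §4 Continuity: `h` continuous ⟺ `σ ↦ ι(h σ)` Fontaine-continuous -/

omit [Fact (¬ IsUnit (p : integerC F))] [IsAdicComplete (Ideal.span {(p : integerC F)}) (integerC F)] in
/-- A `ℤ_p(1)`-valued map is continuous iff its discrete logarithm `log_ε ∘ h : X → ℤ_p` is (`epsLineEquiv` is a homeomorphism:
`continuous_padicLineEquiv`, `continuous_padicLineEquiv_symm`). [cite: NeukirchSchmidtWingberg2008, II §7 (2.7.5)] -/
theorem continuous_iff_continuous_epsLineEquiv_symm_comp {X : Type*} [TopologicalSpace X]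
    (h : X → (muPadicSystem F p).limit) : Continuous h ↔ Continuous fun x => (epsLineEquiv F p).symm (h x) := by
  refine ⟨fun hh => (continuous_padicLineEquiv_symm _ _).comp hh, fun hh => ?_⟩
  have e : h = fun x => epsLineEquiv F p ((epsLineEquiv F p).symm (h x)) := funext fun x => by rw [AddEquiv.apply_symm_apply]
  rw [e]
  exact (continuous_padicLineEquiv _ _).comp hh

/-- ★ **If `σ ↦ ι(h σ)` is Fontaine-continuous then `h : Γ_F → ℤ_p(1)(F̄)` is continuous** (`ι(h σ) = log_ε(h σ) · t`;
`continuous_of_uc_qpToBdR_mul_tBdR` gives continuity of `log_ε ∘ h`, and `epsLineEquiv` is a homeomorphism) — the continuity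
input of `IsCoboundaryLift.twoCocycleClass_eq` for a `ℤ_p(1)`-valued correction cochain, in `B_dR⁺`-currency.
[cite: FontaineAsterisque223III, Exp. II §1.5.3–1.5.5] [cite: Kato1993LNM1553, Ch. II §1.2.5 and Lemma 1.4.3] -/
theorem continuous_of_uc_periodLine (hp : valuation F p < 1) (hF : Function.Surjective (fontaineTheta (integerC F) p))
    {h : absoluteGaloisGroup F → (muPadicSystem F p).limit}
    (hh : ∀ N k : ℕ, ∃ U : OpenSubgroup (absoluteGaloisGroup F), ∀ σ : absoluteGaloisGroup F, ∀ τ ∈ U,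
      ∃ (b : Ainf (p := p) F) (w : BDeRhamPlus (integerC F) p),
        (of F p).symm (periodLine F p (h (σ * τ))) - (of F p).symm (periodLine F p (h σ)) =
          ainfToBdR ((p : Ainf (p := p) F) ^ N * b) + xiBdR ^ k * w) :
    Continuous h := by
  simp only [of_symm_periodLine] at hh
  exact (continuous_iff_continuous_epsLineEquiv_symm_comp h).2
    (GaloisContinuity.continuous_of_uc_qpToBdR_mul_tBdR hp hF (a := fun σ => (epsLineEquiv F p).symm (h σ)) hh)

/-- **Conversely, if `h : Γ_F → ℤ_p(1)(F̄)` is continuous then `σ ↦ ι(h σ)` is Fontaine-continuous.**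
[cite: FontaineAsterisque223III, Exp. II §1.5.3] [cite: Kato1993LNM1553, Ch. II §1.2.5] -/
theorem uc_periodLine_of_continuous {h : absoluteGaloisGroup F → (muPadicSystem F p).limit} (hh : Continuous h) :
    ∀ N k : ℕ, ∃ U : OpenSubgroup (absoluteGaloisGroup F), ∀ σ : absoluteGaloisGroup F, ∀ τ ∈ U,
      ∃ (b : Ainf (p := p) F) (w : BDeRhamPlus (integerC F) p),
        (of F p).symm (periodLine F p (h (σ * τ))) - (of F p).symm (periodLine F p (h σ)) =
          ainfToBdR ((p : Ainf (p := p) F) ^ N * b) + xiBdR ^ k * w := by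
  simp only [of_symm_periodLine]
  exact GaloisContinuity.uc_qpToBdR_coe_mul_tBdR_of_continuous (a := fun σ => (epsLineEquiv F p).symm (h σ))
    ((continuous_iff_continuous_epsLineEquiv_symm_comp h).1 hh)

/-! ## §5 Bloch–Kato Ex. 3.10.1 for `𝔾_m` as a coboundary lift, and the cochain `b(τ) · ℓ_u` presenting `κ_u ∪ b` -/

section Unit

variable (hp : valuation F p < 1) (hF : Function.Surjective (fontaineTheta (integerC F) p))

/-- **`ℓ_u ∈ B_dR⁺(F)` for `u ∈ F`, `0 < |u| ≤ 1`**: the tree's `B_dR⁺`-integral `kummerUnitLog` (`log([ũ] · u⁻¹) ∈ Fil¹`) of the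
Kummer cocycle of `u`, at the root system `rootTilt` of `u` read in `F̄` (abbreviation fixing the six arguments).
[cite: BlochKato1990, Ex. 3.10.1] [cite: Kato1993LNM1553, Ch. II §1.4.4] -/
abbrev unitKummerLog {u : F} (hu : u ≠ 0) (hu1 : ‖algebraMap F (NormedAlgClosure F) u‖ ≤ 1) : BdRPlusTop F p :=
  (kummerUnitLog hp hF (rootTilt p (algebraMap F (NormedAlgClosure F) u) hu1) (algebraMap F (NormedAlgClosure F) u)
    (algebraMap_normedAlgClosure_ne_zero hu) (coe_untilt_rootTilt _ hu1) : BdRPlusTop F p)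

/-- ★★ **Bloch–Kato Ex. 3.10.1 for `𝔾_m`, coboundary-lift form.** For `u ∈ F` with `0 < |u| ≤ 1` and EVERY `σ ∈ Γ_F`:
`ι(κ_u(σ)) = σ(ℓ_u) − ℓ_u` in `B_dR⁺(F)`, where `κ_u = rootKummerCocycle p hu` is the explicit cocycle representing
`κ_∞(u) ∈ H¹(F, ℤ_p(1))` and `ℓ_u = log([ũ] · u⁻¹) ∈ Fil¹` its `B_dR⁺`-integral (`gal_kummerUnitLog_eq` read through
`rootKummerCocycle_apply_eq_epsLineEquiv` and `periodLine_epsLineEquiv`). This is verbatim the hypothesis `ha` of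
`ContPairing.isCoboundaryLift_cupCocycle_left` with `X̃ = B_dR⁺`, `ιX = ι`, `πX = galRepr`, `x₀ = ℓ_u`.
[cite: BlochKato1990, Ex. 3.10.1] [cite: Kato1993LNM1553, Ch. II §1.4.4] [cite: FontaineAsterisque223III, Exp. II §1.5.4] -/
theorem periodLine_rootKummerCocycle {u : F} (hu : u ≠ 0) (hu1 : ‖algebraMap F (NormedAlgClosure F) u‖ ≤ 1)
    (σ : absoluteGaloisGroup F) :
    periodLine F p ((rootKummerCocycle p hu).1 σ) = gal F p σ (unitKummerLog hp hF hu hu1) - unitKummerLog hp hF hu hu1 := by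
  rw [rootKummerCocycle_apply_eq_epsLineEquiv, periodLine_epsLineEquiv, unitKummerLog,
    gal_kummerUnitLog_eq hp hF σ (algebraMap_normedAlgClosure_ne_zero hu) hu1 (NormedAlgClosure.smul_algebraMap σ u),
    add_sub_cancel_left]

omit [CharZero F] in
variable (F p) in
/-- The extended pairing `B_dR⁺ × ℤ_p → B_dR⁺`, `(x, a) ↦ a · x`, through which the twist pairing `ℤ_p(1) × ℤ_p → ℤ_p(1)`,
`(ζ, a) ↦ ζ^a`, extends along `ι` (`ι(ζ^a) = a · ι(ζ)`). [cite: Kato1993LNM1553, Ch. II §1.4.4] -/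
private def smulPairing : BdRPlusTop F p →+ ℤ_[p] →+ BdRPlusTop F p :=
  AddMonoidHom.mk' (fun x => AddMonoidHom.mk' (fun a => of F p (qpToBdR (a : ℚ_[p])) * x) fun a b => by
      simp only [PadicInt.coe_add, map_add, add_mul])
    fun x y => AddMonoidHom.ext fun a => by simp only [AddMonoidHom.mk'_apply, AddMonoidHom.add_apply, mul_add]

omit [CharZero F] in
/-- Unfolding `smulPairing`. [cite: Kato1993LNM1553, Ch. II §1.4.4] -/
private theorem smulPairing_apply (x : BdRPlusTop F p) (a : ℤ_[p]) :
    smulPairing F p x a = of F p (qpToBdR (a : ℚ_[p])) * x := rfl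

/-- ★★ **The cochain `τ ↦ b(τ) · ℓ_u` presents `κ_u ∪ b` through `ι`** (Kato II §1.4.4, `b = log χ_cyclo`; Bloch–Kato 3.10.1):
for `u ∈ F`, `0 < |u| ≤ 1`, and every continuous `1`-cocycle `b : Γ_F → ℤ_p` of the trivial representation (a character),
`ι((κ_u ∪ b)(σ, τ)) = σ(b(τ) ℓ_u) − b(στ) ℓ_u + b(σ) ℓ_u` for the twist cup product `ℤ_p(1) × ℤ_p → ℤ_p(1)`
(`twistPairingPadic`), i.e. `IsCoboundaryLift galRepr ι (τ ↦ b(τ) · ℓ_u) (κ_u ∪ b)` — `ContPairing.isCoboundaryLift_cupCocycle_left`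
with the ambient `B_dR⁺`, `x₀ = ℓ_u`, and §5's coboundary identity. [cite: Kato1993LNM1553, Ch. II §1.4.4 and proof of Lemma 1.4.3]
[cite: BlochKato1990, Ex. 3.10.1] -/
theorem isCoboundaryLift_twistPairingPadic_rootKummerCocycle {u : F} (hu : u ≠ 0)
    (hu1 : ‖algebraMap F (NormedAlgClosure F) u‖ ≤ 1) (b : contOneCocycles (padicTrivRep F p).toTopRep) :
    IsCoboundaryLift (ρ := tateModuleMuPadic F p) (galRepr F p) (periodLine F p)
      (fun τ => of F p (qpToBdR ((b.1 τ : ℤ_[p]) : ℚ_[p])) * unitKummerLog hp hF hu hu1)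
      ((twistPairingPadic F p).cupCocycle (rootKummerCocycle p hu) b) :=
  (twistPairingPadic F p).isCoboundaryLift_cupCocycle_left (π := galRepr F p) (ι := periodLine F p)
    (πX := galRepr F p) (ιX := periodLine F p) (Pt := smulPairing F p)
    (fun σ x a => by
      rw [smulPairing_apply, smulPairing_apply, galRepr_apply, galRepr_apply, map_mul, gal_of, galBdRPlus_qpToBdR]
      rfl)
    (fun ζ a => by rw [smulPairing_apply, twistPairingPadic_toLin_apply, periodLine_twistHom])
    (rootKummerCocycle p hu) (unitKummerLog hp hF hu hu1) (periodLine_rootKummerCocycle hp hF hu hu1) b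

variable [LocallyCompactSpace (absoluteGaloisGroup F)]

/-- Hence **`[κ_u ∪ b] ∈ H²(F, ℤ_p(1))` is the class of ANY continuous `2`-cocycle `c` presented by `τ ↦ b(τ) · ℓ_u` through `ι`**
(`ι` injective: `θ` surjective). With `b = log χ_cyclo` this is the cochain-level half of Kato II Lemma 1.4.5 in `B_dR⁺`-currency;
`inv_∞` of the left-hand side is the tree's `invPadic_cupProduct_kummerPadic_eq_neg(_mul)_of_isCyclotomic` (after
`oneCocycleClass_rootKummerCocycle`). [cite: Kato1993LNM1553, Ch. II §1.4.4 and Lemma 1.4.5] [cite: BlochKato1990, Ex. 3.10.1] -/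
theorem cupClass_rootKummerCocycle_eq_twoCocycleClass {u : F} (hu : u ≠ 0)
    (hu1 : ‖algebraMap F (NormedAlgClosure F) u‖ ≤ 1) (b : contOneCocycles (padicTrivRep F p).toTopRep)
    {c : contTwoCocycles (tateModuleMuPadic F p).toTopRep}
    (hc : IsCoboundaryLift (ρ := tateModuleMuPadic F p) (galRepr F p) (periodLine F p)
      (fun τ => of F p (qpToBdR ((b.1 τ : ℤ_[p]) : ℚ_[p])) * unitKummerLog hp hF hu hu1) c) :
    (twistPairingPadic F p).cupClass (rootKummerCocycle p hu) b = twoCocycleClass (tateModuleMuPadic F p).toTopRep c := by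
  rw [ContPairing.cupClass_eq_twoCocycleClass,
    (isCoboundaryLift_twistPairingPadic_rootKummerCocycle hp hF hu hu1 b).unique (periodLine_injective hF) hc]

end Unit

end BdRPlusTop

end Literature.NumberTheory.PAdicHodge

end
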